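import Summits.BirchSwinnertonDyer.BirchSwinnertonDyer.Theorems.SignedLowerHalvesKobayashiLowerHalfLargeImageShadowConductor
import Literature.NumberTheory.EllipticCurves.TorsionThreeConductorExponentTypeIVProofs
import HarnessLib

/-!
# Crux `KobayashiLowerHalfLargeImage` (item stmt-BirchSwinnertonDyer-19001), line `shadow_seed`:
# the COMPLETE `p = 3` table of the Serre conductor exponent of `E[3]` at an additive place `v ∤ 6` —
# `a_v(E[3]) = f_v(E) − [type ∈ {IV, IV*}]` — and `q ∥ N(ρ̄_{E,3})` at EVERY shadow prime `q ≥ 5`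

HONEST FRAMING (D-0152). Route K3 = `SignedLowerHalves` is a CLASS route; crux 3
(`Theses.SignedLowerHalves.KobayashiLowerHalfLargeImage`) is the Eisenstein half of Kobayashi's signed
main conjecture on the large-image corner of X7. NOTHING here proves the crux, the route, or BSD. This
file is a HELPER of item 19001 (`--supports`), sequel of
`Theorems/SignedLowerHalvesKobayashiLowerHalfLargeImageShadowConductor.lean` (p662767: types `≠ IV, IV*`
keep the exponent; `IV`/`IV*` with `3 ∣ c_v` drop it), closing the cell left open there — types `IV`/`IV*`
with `c_v = 1` — with `Literature/…/TorsionThreeConductorExponentTypeIVProofs.lean` (w2 g8: at a place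
`v ∤ 6` of type `IV`/`IV*` the exponent is `1` WHATEVER `c_v`, from the exact index `3` of `E₀` in
`E(K_v^nr)`, `KodairaNeronUnramifiedTypeIVIndexProofs` / `InertiaFixedTorsionTypeIVProofs`):

* `artinConductorExponent_torsion_three_eq_ite_of_hasAdditiveReductionAt` — for `E/K` over a number
  field and an additive place `v ∤ 6`: **`a_v(E[3]) = if type_v ∈ {IV, IV*} then 1 else 2`**, with
  `f_v(E) = 2` (`conductorExponent_eq_two_of_hasAdditiveReductionAt`); equivalently
  `artinConductorExponent_torsion_three_add_eq_conductorExponent`: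
  `a_v(E[3]) + [type_v ∈ {IV, IV*}] = f_v(E)` — Darmon–Diamond–Taylor's recipe
  `m_v(ρ̄) = f_v(E) − dim E[3]^{I_v}`, `E[3]^{I_v} ≅ Φ_v(k̄)[3]`, in the kernel at every additive `v ∤ 6`.
* over `ℚ`, in the `ℚ_q`/`ℤ_q` currency of `ShadowSeed.IsShadowPrimeAt`:
  **`Rat.artinConductorExponent_torsion_three_eq_one_of_kodairaSymbol_padic'`** — prime `q ≥ 5`,
  `(E.baseChange ℚ_[q]).kodairaSymbol ℤ_[q] ∈ {IV, IV*}` ⇒ `a_v(E[3]) = 1` at the place `v` of `𝓞 ℚ` over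
  `q`, WITHOUT the Tamagawa clause of the unprimed version (so both shadow branches `q ≡ ±1 (mod 3)`);
  `Rat.artinConductorExponent_torsion_three_eq_two_of_kodairaSymbol_padic_ne` — additive `ℤ_q`-type
  `≠ IV, IV*` ⇒ `a_v(E[3]) = 2`.

Nothing is asserted about any particular curve; no modular form enters; BSD is not proved by any of this.

References: [DarmonDiamondTaylor1995] §2.1, Lemma 2.7; [Serre1987] §1.2; [SilvermanATAEC1994] §IV.10,
Table 4.1; [SilvermanAEC2009] Thm. VII.6.1.
-/

set_option linter.dupNamespace false

noncomputable section

open scoped Classical NumberField Pointwise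
open Field IsDedekindDomain IsDedekindDomain.HeightOneSpectrum NumberField

attribute [local instance] AddSubgroup.torsionBy.zmodModule

universe u

namespace Summit.BirchSwinnertonDyer.BirchSwinnertonDyer.Theorems.ShadowConductor

open Literature.NumberTheory.EllipticCurves Literature.NumberTheory.GaloisRepresentations
  Literature.NumberTheory.DiophantineGeometry WeierstrassCurve
  Summit.BirchSwinnertonDyer.Rank1Residual

variable {K : Type u} [Field K] [NumberField K] (W : WeierstrassCurve K) {v : HeightOneSpectrum (𝓞 K)}

/-! ### The complete `p = 3` table at an additive `v ∤ 6` -/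

/-- **`f_v(E) = 2` at an additive place `v ∤ 6`** (`f_v = ε_v`, `conductorExponent_eq_tameConductorExponent_holds`;
`ε_v = 2` at an additive type). [cite: SilvermanATAEC1994, Thm. IV.10.2 and IV.10.4 (PDF pp. 358–362)] -/
theorem conductorExponent_eq_two_of_hasAdditiveReductionAt [W.IsElliptic]
    (hadd : W.HasAdditiveReductionAt v) (h2 : (2 : 𝓞 K) ∉ v.asIdeal) (h3 : (3 : 𝓞 K) ∉ v.asIdeal) :
    W.conductorExponent v = 2 := by
  haveI : PerfectField (IsLocalRing.ResidueField (v.adicCompletionIntegers K)) :=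
    PerfectField.ofFinite
  rw [conductorExponent_eq_tameConductorExponent_holds v W
      (v.ringChar_ne_of_natCast_notMem (p := 2) (by exact_mod_cast h2))
      (v.ringChar_ne_of_natCast_notMem (p := 3) (by exact_mod_cast h3)),
    (KodairaSymbol.tameConductorExponent_eq_two_iff _).mpr
      ((isAdditive_kodairaSymbolAt_iff_holds v W).mpr hadd)]

/-- **The `p = 3` table: `a_v(E[3]) = if type_v ∈ {IV, IV*} then 1 else 2` at every additive place
`v ∤ 6`** of an elliptic curve over a number field — `1` at the types `IV`, `IV*` whatever `c_v`
(`WeierstrassCurve.artinConductorExponent_torsion_three_eq_one_of_kodairaSymbolAt`: `E[3]^{I_v} ≅ Φ_v(k̄)[3]`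
is a line), `2 = f_v(E)` at the other additive types
(`artinConductorExponent_torsion_three_eq_conductorExponent_of_ne_IV`: `3 ∤ #Φ_v(k̄)`, `E[3]^{I_v} = 0`).
[cite: DarmonDiamondTaylor1995, §2.1 (p. 54), Lemma 2.7 and Remark 2.14]
[cite: SilvermanATAEC1994, Table 4.1 (PDF p. 365) and Thm. IV.10.2] -/
theorem artinConductorExponent_torsion_three_eq_ite_of_hasAdditiveReductionAt [W.IsElliptic]
    (hadd : W.HasAdditiveReductionAt v) (h2 : (2 : 𝓞 K) ∉ v.asIdeal) (h3 : (3 : 𝓞 K) ∉ v.asIdeal) :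
    (W.torsionGaloisRep 3).artinConductorExponent v =
      if W.kodairaSymbolAt v = .IV ∨ W.kodairaSymbolAt v = .IVstar then 1 else 2 := by
  split_ifs with hT
  · exact W.artinConductorExponent_torsion_three_eq_one_of_kodairaSymbolAt h2 h3 hT
  · rw [not_or] at hT
    rw [artinConductorExponent_torsion_three_eq_conductorExponent_of_ne_IV W hadd h2 h3 hT.1 hT.2,
      conductorExponent_eq_two_of_hasAdditiveReductionAt W hadd h2 h3]

/-- **`a_v(E[3]) + [type_v ∈ {IV, IV*}] = f_v(E)`** at every additive place `v ∤ 6`: the Serre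
exponent of `E[3]` drops by exactly one at the types `IV`, `IV*` and is kept otherwise
(Darmon–Diamond–Taylor `m_v(ρ̄) = f_v(E) − dim E[3]^{I_v}` with `E[3]^{I_v} ≅ Φ_v(k̄)[3]`).
[cite: DarmonDiamondTaylor1995, Lemma 2.7 and Remark 2.14] [cite: Serre1987, §1.2 (definition of N(ρ))] -/
theorem artinConductorExponent_torsion_three_add_eq_conductorExponent [W.IsElliptic]
    (hadd : W.HasAdditiveReductionAt v) (h2 : (2 : 𝓞 K) ∉ v.asIdeal) (h3 : (3 : 𝓞 K) ∉ v.asIdeal) :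
    (W.torsionGaloisRep 3).artinConductorExponent v +
        (if W.kodairaSymbolAt v = .IV ∨ W.kodairaSymbolAt v = .IVstar then 1 else 0) =
      W.conductorExponent v := by
  rw [artinConductorExponent_torsion_three_eq_ite_of_hasAdditiveReductionAt W hadd h2 h3,
    conductorExponent_eq_two_of_hasAdditiveReductionAt W hadd h2 h3]
  split_ifs <;> rfl

/-! ### Over `ℚ`: every shadow prime `q ≥ 5` -/

section Rat

open Rat.HeightOneSpectrum

variable (E : WeierstrassCurve ℚ) [E.IsElliptic] (v : HeightOneSpectrum (𝓞 ℚ))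

/-- `p ∉ v` for a prime `p` different from the residue characteristic of `v` (Mathlib
`Rat.HeightOneSpectrum.natGenerator_dvd_iff`); private plumbing. [folklore] -/
private theorem natCast_notMem_of_primesEquiv_ne' {p : ℕ} (hp : p.Prime)
    (hv : ((primesEquiv v : Nat.Primes) : ℕ) ≠ p) : ((p : ℕ) : 𝓞 ℚ) ∉ v.asIdeal := by
  intro hmem
  apply hv
  change natGenerator v = p
  rw [← Nat.prime_dvd_prime_iff_eq (prime_natGenerator v) hp, natGenerator_dvd_iff,
    ← map_natCast (Rat.IsIntegralClosure.intEquiv (𝓞 ℚ)) p]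
  exact Ideal.mem_map_of_mem _ hmem

/-- **`a_v(E[3]) = 1` (`q ∥ N(ρ̄_{E,3})`) at a place of `ℚ` over ANY prime `q ≥ 5` of Kodaira type `IV`
or `IV*`** — no Tamagawa clause (both shadow branches of `ShadowSeed.IsShadowPrimeAt`: `c_q = 3` for
`q ≡ 2 (mod 3)` and `c_q = 1` for `q ≡ 1 (mod 3)`), by
`WeierstrassCurve.artinConductorExponent_torsion_three_eq_one_of_kodairaSymbolAt` through
`kodairaSymbolAt_eq_padic`.  With `Rat.conductorExponent_eq_two_of_kodairaSymbol_padic`: `q² ∥ N_E`,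
`q ∥ N(ρ̄)` — Diamond's level-lowered newform is Steinberg at `q`.
[cite: Serre1987, §1.2 (definition of N(ρ)) and §4] [cite: DarmonDiamondTaylor1995, Lemma 2.7 and Remark 2.14]
[cite: SilvermanATAEC1994, Table 4.1 (PDF p. 365)] -/
theorem Rat.artinConductorExponent_torsion_three_eq_one_of_kodairaSymbol_padic' {q : ℕ} [Fact q.Prime]
    (hv : ((primesEquiv v : Nat.Primes) : ℕ) = q) (h5 : 5 ≤ q)
    (hK : (E.baseChange ℚ_[q]).kodairaSymbol ℤ_[q] = .IV ∨
      (E.baseChange ℚ_[q]).kodairaSymbol ℤ_[q] = .IVstar) :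
    (E.torsionGaloisRep 3).artinConductorExponent v = 1 := by
  subst hv
  have h2 : ((2 : ℕ) : 𝓞 ℚ) ∉ v.asIdeal :=
    natCast_notMem_of_primesEquiv_ne' v Nat.prime_two (by omega)
  have h3 : ((3 : ℕ) : 𝓞 ℚ) ∉ v.asIdeal :=
    natCast_notMem_of_primesEquiv_ne' v Nat.prime_three (by omega)
  have hT : E.kodairaSymbolAt v = .IV ∨ E.kodairaSymbolAt v = .IVstar := by
    rw [kodairaSymbolAt_eq_padic v E]; exact hK
  exact E.artinConductorExponent_torsion_three_eq_one_of_kodairaSymbolAt (by exact_mod_cast h2)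
    (by exact_mod_cast h3) hT

/-- **`a_v(E[3]) = 2 = f_q(E)` at a place of `ℚ` over a prime `q ≥ 5` of an ADDITIVE Kodaira type other
than `IV`, `IV*`** (`ℤ_q`-type; the exponent is kept).
[cite: DarmonDiamondTaylor1995, §2.1 and Lemma 2.7] [cite: SilvermanATAEC1994, Table 4.1 (PDF p. 365) and Thm. IV.10.2] -/
theorem Rat.artinConductorExponent_torsion_three_eq_two_of_kodairaSymbol_padic_ne {q : ℕ} [Fact q.Prime]
    (hv : ((primesEquiv v : Nat.Primes) : ℕ) = q) (h5 : 5 ≤ q)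
    (hK : ((E.baseChange ℚ_[q]).kodairaSymbol ℤ_[q]).IsAdditive)
    (hIV : (E.baseChange ℚ_[q]).kodairaSymbol ℤ_[q] ≠ .IV)
    (hIVs : (E.baseChange ℚ_[q]).kodairaSymbol ℤ_[q] ≠ .IVstar) :
    (E.torsionGaloisRep 3).artinConductorExponent v = 2 ∧ E.conductorExponent v = 2 := by
  haveI : PerfectField (IsLocalRing.ResidueField (v.adicCompletionIntegers ℚ)) :=
    PerfectField.ofFinite
  subst hv
  have h2 : ((2 : ℕ) : 𝓞 ℚ) ∉ v.asIdeal :=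
    natCast_notMem_of_primesEquiv_ne' v Nat.prime_two (by omega)
  have h3 : ((3 : ℕ) : 𝓞 ℚ) ∉ v.asIdeal :=
    natCast_notMem_of_primesEquiv_ne' v Nat.prime_three (by omega)
  have hk : (E.kodairaSymbolAt v).IsAdditive := by rwa [kodairaSymbolAt_eq_padic v E]
  have hIV' : E.kodairaSymbolAt v ≠ .IV := by rwa [kodairaSymbolAt_eq_padic v E]
  have hIVs' : E.kodairaSymbolAt v ≠ .IVstar := by rwa [kodairaSymbolAt_eq_padic v E]
  have hadd : E.HasAdditiveReductionAt v := (isAdditive_kodairaSymbolAt_iff_holds v E).mp hk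
  have hf := conductorExponent_eq_two_of_hasAdditiveReductionAt E hadd (by exact_mod_cast h2)
    (by exact_mod_cast h3)
  refine ⟨?_, hf⟩
  rw [← hf]
  exact artinConductorExponent_torsion_three_eq_conductorExponent_of_ne_IV E hadd
    (by exact_mod_cast h2) (by exact_mod_cast h3) hIV' hIVs'

end Rat

end Summit.BirchSwinnertonDyer.BirchSwinnertonDyer.Theorems.ShadowConductor

end
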